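import Literature.Probability.RandomPlanarGeometry.HexSAWSurfaceYcLimitAllY
import Mathlib.Analysis.SpecificLimits.Basic
import HarnessLib

/-!
# The critical surface fugacity `1 + √2` is the exponential PRICE of a surface visit: for every `b > 0`,
# `(∃ sub-exponential C, ∀ n k, #{n-step half-plane SAWs from the surface with ≥ k surface visits} ≤ C(n) μⁿ b⁻ᵏ) ↔ b ≤ 1 + √2`,
# with the explicit admissible `C(n) = (n+1) · (μ³/(1+√2)) · e^{12√n}` at `b = 1 + √2`

Topic `Literature/Probability/RandomPlanarGeometry` (lane «pcv-sawmu», a-idea-1 g26, door «VISIT-PRICE»; continues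
`HexSAWSurfaceWallBridges.lean` / `HexSAWSurfaceYcLimitAllY.lean` — honeycomb self-avoiding walks in the brick-wall frame with
the adsorbing surface the row `Y = 0`: half-plane walks `hpw n` from a surface vertex, their surface visits `visits n ω`, the
partition functions `Cw n y = Σ_{hpw n} y^{visits}`, wall bridges `wbr m` with `WB m y`, the wall-bridge rate `β(y) = wallRate y`
and BBdGDCG14's half-plane rate `μ(y) = surfaceMu y = max(β(y), μ)` with `μ(y) = μ ↔ y ≤ 1 + √2`).

Sources, AS PRINTED.  E. J. Janse van Rensburg, *The Statistical Mechanics of Interacting Walks, Polygons, Animals and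
Vesicles* (OUP 2000), §5.4.2 (held first-edition text, chunk p0185): for adsorbing (positive) polygons with density function of visits `𝒫ᵥ⁺`,
"the concavity of `log 𝒫ᵥ⁺(ε)` shows that  `log 𝒫ᵥ⁺(ε) ≤ log μ_d − ε log z_c⁺`  (5.62)", and, by Lemma 3.20 (chunk p0065:
"`log z_c = −[d⁺/dε log 𝒫_#(ε)]|_{ε = ε_m⁺}`"), "`log z_c⁺ = −[d⁺/dε log 𝒫ᵥ⁺(ε)]|_{ε=0⁺}`  (5.63)": the exponential cost per
unit density of visits in the desorbed phase is EXACTLY `log z_c`.  N. R. Beaton, M. Bousquet-Mélou, J. de Gier,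
H. Duminil-Copin, A. J. Guttmann, *The critical fugacity for surface adsorption of self-avoiding walks on the honeycomb lattice
is `1+√2`*, Comm. Math. Phys. 326 (2014) 727–754, Theorem 2 (arXiv:1109.0358v5 p. 3: "The critical surface fugacity for self-avoiding walks on the honeycomb
lattice is `y_c = 1+√2`") and §3.1 Proposition 5 (p. 9: `μ(y) = μ` if `y ≤ y_c`, `> μ` if `y > y_c`).  J. M. Hammersley, G. M. Torrie, S. G. Whittington, *Self-avoiding walks
interacting with a surface*, J. Phys. A 15 (1982) 539–571, §2 (the last-visit decomposition; wall/surface bridges).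
J. M. Hammersley, D. J. A. Welsh, Quart. J. Math. 13 (1962) 108–110 (the `e^{O(√n)}` unfolding bound).

What is proved here (everything imports only `HexSAWSurfaceYcLimitAllY`; no numerics).
* `hpwVis n k` / `wbrVis m k` — the `n`-step half-plane walks from the surface vertex (resp. `m`-step wall bridges) with AT
  LEAST `k` surface visits; exponential Chebyshev: **`card_hpwVis_mul_pow_le_Cw (hy : 1 ≤ y) : #hpwVis n k · yᵏ ≤ Cw n y`**,
  `card_wbrVis_mul_pow_le_WB`.
* At the critical fugacity: `wallRate_yc_le : β(1+√2) ≤ μ`, `WB_yc_le : WB m (1+√2) ≤ (μ²/(1+√2)) μᵐ` (Fekete's bound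
  `WB_le_pow` — NO sub-exponential factor for wall bridges), `Cw_yc_le : Cw n (1+√2) ≤ (n+1)(μ³/(1+√2)) e^{12√n} μⁿ` (the tree's
  `Cw_le`: last-visit split + arch unfolding + Hammersley–Welsh).
* ★ **`card_wbrVis_le (m k) : #wbrVis m k ≤ (μ²/(1+√2)) · μᵐ / (1+√2)ᵏ`** and
  ★★ **`card_hpwVis_le (n k) : #hpwVis n k ≤ ((n+1) · (μ³/(1+√2)) · e^{12√n}) · μⁿ / (1+√2)ᵏ`** — the finite-`n`, explicit form
  of (5.62) for honeycomb half-plane WALKS, with the rigorous `z_c = 1 + √2` of BBdGDCG14: every forced surface visit costs a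
  factor `1 + √2` against the bulk count `μⁿ`, uniformly in `n` and `k`, up to the displayed sub-exponential factor; the general
  Chernoff family **`card_hpwVis_le_of_one_le (hy : 1 ≤ y) : #hpwVis n k ≤ ((n+1)(μ·μ(y)²/y) e^{12√n}) · μ(y)ⁿ / yᵏ`** (optimise
  over `y`: the Legendre transform of `log μ(·)`, cf. JvR Theorem 3.19).
* ★★ **`isVisitPrice_iff (hb : 0 < b) : IsVisitPrice b ↔ b ≤ 1 + √2`**, where
  `IsVisitPrice b := ∃ C, (∀ s > 1, eventually C n ≤ sⁿ) ∧ ∀ n k, #hpwVis n k ≤ C n · μⁿ / bᵏ` — the finite form of (5.63):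
  `1 + √2` IS an admissible price (`isVisitPrice_yc`, with the explicit `C` above, `eventually_pricePrefactor_le_pow`), and NO
  `b > 1 + √2` is (`not_isVisitPrice_of_yc_lt`: a price `b` would make `Cw n y`, `y_c < y < b`, grow no faster than `μⁿ·e^{o(n)}`
  by summing the geometric series `Σ_k (y/b)ᵏ`, against `β(y) > μ` — `hexConnectiveConstant_lt_wallRate_iff` and the lower
  estimate `eventually_mul_pow_le_Cw` of the tree); `isGreatest_isVisitPrice` packages it as `IsGreatest {b | IsVisitPrice b} (1+√2)`.

Label (lane «pcv-sawmu»).  CONSOLIDATION WITH A RATE of the printed density-function statements (5.62)/(5.63) (there: limiting,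
for polygons in `ℤᵈ`, resting on the existence of the density function, JvR Theorem 5.53 / Assumptions 3.1, which is NOT in the
tree), typed here for honeycomb half-plane walks in a finite-`n` form that needs no density function; what is new in writing
(modest) is only the explicit finite-`n` constant and the density-function-free `↔`.  Why this is the natural statement: in the
desorbed phase `y ≤ y_c` the free energy is constant (`μ(y) = μ`), and by exponential Chebyshev that is the same thing as an
exponential tail of the number of visits with rate `log y_c` — the converse direction is exactly where `μ(y) > μ` for `y > y_c`
(BBdGDCG14 Theorem 2) enters.  NOT claimed: sharpness of the tail for fixed density `k/n = ε > 0` (that is the density function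
itself, `log 𝒫ᵥ(ε) = inf_y {log μ(y) − ε log y}`, whose finite-`n` lower half needs the concatenation theory of JvR §3), nor
anything at `y > y_c`.
-/

noncomputable section

open Finset Filter Function
open Literature.Probability.LatticeModels Literature.Probability.Percolation SimpleGraph
open Literature.Combinatorics.Enumerative
open _root_.Topology

namespace Literature.Probability.RandomPlanarGeometry.SAW.HexBW.Wall

open Literature.Probability.RandomPlanarGeometry.SAW.HV

variable {y : ℝ}

/-! ## §1 Walks with at least `k` surface visits; exponential Chebyshev -/

open Classical in
/-- `hpwVis n k`: the `n`-step half-plane self-avoiding walks from the surface vertex (`hpw n`) with at least `k` surface visits.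
[cite: JansevanRensburg2000, §5.4.2, eq. (5.62) (the density function of visits `𝒫ᵥ⁺` of positive polygons)] [cite: HammersleyTorrieWhittington1982, §2] -/
def hpwVis (n k : ℕ) : Finset (ℕ → Site 2) := (hpw n).filter (fun ω => k ≤ visits n ω)

open Classical in
/-- `wbrVis m k`: the `m`-step wall bridges (`wbr m`) with at least `k` surface visits.
[cite: HammersleyTorrieWhittington1982, §2] [cite: JansevanRensburg2000, §5.4.2] -/
def wbrVis (m k : ℕ) : Finset (ℕ → Site 2) := (wbr m).filter (fun ω => k ≤ visits m ω)

/-- Membership in `hpwVis`. [cite: JansevanRensburg2000, §5.4.2] -/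
theorem mem_hpwVis {n k : ℕ} {ω : ℕ → Site 2} : ω ∈ hpwVis n k ↔ ω ∈ hpw n ∧ k ≤ visits n ω := by
  classical
  exact Finset.mem_filter

/-- Membership in `wbrVis`. [cite: HammersleyTorrieWhittington1982, §2] -/
theorem mem_wbrVis {m k : ℕ} {ω : ℕ → Site 2} : ω ∈ wbrVis m k ↔ ω ∈ wbr m ∧ k ≤ visits m ω := by
  classical
  exact Finset.mem_filter

/-- `hpwVis n k ⊆ hpw n`. [cite: JansevanRensburg2000, §5.4.2] -/
theorem hpwVis_subset (n k : ℕ) : hpwVis n k ⊆ hpw n := fun _ h => (mem_hpwVis.1 h).1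

/-- `wbrVis m k ⊆ wbr m`. [cite: HammersleyTorrieWhittington1982, §2] -/
theorem wbrVis_subset (m k : ℕ) : wbrVis m k ⊆ wbr m := fun _ h => (mem_wbrVis.1 h).1

/-- No threshold: `hpwVis n 0 = hpw n`. [cite: JansevanRensburg2000, §5.4.2] -/
theorem hpwVis_zero (n : ℕ) : hpwVis n 0 = hpw n := by
  ext ω; simp [mem_hpwVis]

/-- The threshold is monotone: `k ≤ k' → hpwVis n k' ⊆ hpwVis n k`. [cite: JansevanRensburg2000, §5.4.2] -/
theorem hpwVis_anti {n k k' : ℕ} (h : k ≤ k') : hpwVis n k' ⊆ hpwVis n k := fun _ hω =>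
  mem_hpwVis.2 ⟨(mem_hpwVis.1 hω).1, h.trans (mem_hpwVis.1 hω).2⟩

/-- More than `n` visits are impossible: `n < k → hpwVis n k = ∅`. (tree `visits_le`). [cite: HammersleyTorrieWhittington1982, §2] -/
theorem hpwVis_eq_empty {n k : ℕ} (h : n < k) : hpwVis n k = ∅ := by
  ext ω
  simp only [Finset.notMem_empty, iff_false]
  intro hω
  exact absurd ((mem_hpwVis.1 hω).2.trans (visits_le n ω)) (not_le.2 h)

/-- **Exponential Chebyshev for half-plane walks: `#hpwVis n k · yᵏ ≤ Cw n y` for `y ≥ 1`.**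
[cite: JansevanRensburg2000, §5.4.2, eq. (5.62) and Theorem 3.19] [cite: HammersleyTorrieWhittington1982, §2] -/
theorem card_hpwVis_mul_pow_le_Cw (hy : 1 ≤ y) (n k : ℕ) : (#(hpwVis n k) : ℝ) * y ^ k ≤ Cw n y := by
  have hy0 : 0 ≤ y := zero_le_one.trans hy
  calc (#(hpwVis n k) : ℝ) * y ^ k = ∑ ω ∈ hpwVis n k, y ^ k := by rw [Finset.sum_const, nsmul_eq_mul]
    _ ≤ ∑ ω ∈ hpwVis n k, y ^ visits n ω :=
        Finset.sum_le_sum fun ω hω => pow_le_pow_right₀ hy (mem_hpwVis.1 hω).2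
    _ ≤ ∑ ω ∈ hpw n, y ^ visits n ω :=
        Finset.sum_le_sum_of_subset_of_nonneg (hpwVis_subset n k) fun _ _ _ => pow_nonneg hy0 _
    _ = Cw n y := rfl

/-- **Exponential Chebyshev for wall bridges: `#wbrVis m k · yᵏ ≤ WB m y` for `y ≥ 1`.**
[cite: HammersleyTorrieWhittington1982, §2] [cite: JansevanRensburg2000, §5.4.2, eq. (5.62)] -/
theorem card_wbrVis_mul_pow_le_WB (hy : 1 ≤ y) (m k : ℕ) : (#(wbrVis m k) : ℝ) * y ^ k ≤ WB m y := by
  have hy0 : 0 ≤ y := zero_le_one.trans hy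
  calc (#(wbrVis m k) : ℝ) * y ^ k = ∑ ω ∈ wbrVis m k, y ^ k := by rw [Finset.sum_const, nsmul_eq_mul]
    _ ≤ ∑ ω ∈ wbrVis m k, y ^ visits m ω :=
        Finset.sum_le_sum fun ω hω => pow_le_pow_right₀ hy (mem_wbrVis.1 hω).2
    _ ≤ ∑ ω ∈ wbr m, y ^ visits m ω :=
        Finset.sum_le_sum_of_subset_of_nonneg (wbrVis_subset m k) fun _ _ _ => pow_nonneg hy0 _
    _ = WB m y := rfl

/-! ## §2 The partition functions AT the critical fugacity `y_c = 1 + √2` grow like `μⁿ` -/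

/-- `0 < 1 + √2`. [cite: BeatonBousquetMelouDeGierDuminilCopinGuttmann2014, Theorem 2 (arXiv v5 p. 3)] -/
theorem yc_pos : (0 : ℝ) < 1 + Real.sqrt 2 := by positivity

/-- `1 ≤ 1 + √2`. [cite: BeatonBousquetMelouDeGierDuminilCopinGuttmann2014, Theorem 2 (arXiv v5 p. 3)] -/
theorem one_le_yc : (1 : ℝ) ≤ 1 + Real.sqrt 2 := le_add_of_nonneg_right (Real.sqrt_nonneg 2)

/-- **At the critical fugacity the wall-bridge rate does not exceed the connective constant: `β(1+√2) ≤ μ`** (`β(y) > μ ↔ y > 1+√2`).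
[cite: BeatonBousquetMelouDeGierDuminilCopinGuttmann2014, Theorem 2 and §3.1 Proposition 5 (arXiv v5 pp. 3, 9)] [cite: HammersleyTorrieWhittington1982, §2] -/
theorem wallRate_yc_le : wallRate (1 + Real.sqrt 2) ≤ hexConnectiveConstant :=
  not_lt.1 fun h => lt_irrefl _ ((hexConnectiveConstant_lt_wallRate_iff yc_pos).1 h)

/-- `μ(1+√2) = μ`. [cite: BeatonBousquetMelouDeGierDuminilCopinGuttmann2014, Theorem 2 and §3.1 Proposition 5 (arXiv v5 pp. 3, 9)] -/
theorem surfaceMu_yc : surfaceMu (1 + Real.sqrt 2) = hexConnectiveConstant := (surfaceMu_eq_iff yc_pos).2 le_rfl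

/-- **Wall bridges at `y_c`, with NO sub-exponential factor: `WB m (1+√2) ≤ (μ²/(1+√2)) · μᵐ`** (Fekete's bound `WB_le_pow` at
`β(1+√2) ≤ μ`). [cite: HammersleyTorrieWhittington1982, §2] [cite: MadrasSlade1993, §1.2, Lemma 1.2.2] [cite: BeatonBousquetMelouDeGierDuminilCopinGuttmann2014, Theorem 2 (arXiv v5 p. 3)] -/
theorem WB_yc_le (m : ℕ) :
    WB m (1 + Real.sqrt 2) ≤ hexConnectiveConstant ^ 2 / (1 + Real.sqrt 2) * hexConnectiveConstant ^ m := by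
  have h := WB_le_pow yc_pos m
  have hβ := wallRate_yc_le
  have hβ0 := (wallRate_pos (1 + Real.sqrt 2)).le
  calc WB m (1 + Real.sqrt 2)
      ≤ wallRate (1 + Real.sqrt 2) ^ 2 / (1 + Real.sqrt 2) * wallRate (1 + Real.sqrt 2) ^ m := h
    _ ≤ hexConnectiveConstant ^ 2 / (1 + Real.sqrt 2) * hexConnectiveConstant ^ m :=
        mul_le_mul (div_le_div_of_nonneg_right (pow_le_pow_left₀ hβ0 hβ 2) yc_pos.le)
          (pow_le_pow_left₀ hβ0 hβ m) (pow_nonneg hβ0 _)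
          (div_nonneg (pow_nonneg hexConnectiveConstant_pos.le _) yc_pos.le)

/-- **Half-plane walks at `y_c`: `Cw n (1+√2) ≤ (n+1) · (μ³/(1+√2)) · e^{12√n} · μⁿ`** (the tree's `Cw_le` — last-visit split,
arch unfolding `e^{6√n}`, Hammersley–Welsh `e^{6√n}` — at `max(β(1+√2), μ) = μ`).
[cite: HammersleyTorrieWhittington1982, §2] [cite: HammersleyWelsh1962, Theorem] [cite: BeatonBousquetMelouDeGierDuminilCopinGuttmann2014, Theorem 2, §3.1 Proposition 5 (arXiv v5 pp. 3, 9)] -/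
theorem Cw_yc_le (n : ℕ) :
    Cw n (1 + Real.sqrt 2) ≤ ((n : ℝ) + 1) * (hexConnectiveConstant ^ 3 / (1 + Real.sqrt 2)) *
      Real.exp (12 * Real.sqrt n) * hexConnectiveConstant ^ n := by
  have h := Cw_le yc_pos n
  have hβ := wallRate_yc_le
  have hβ0 := (wallRate_pos (1 + Real.sqrt 2)).le
  have hμ := hexConnectiveConstant_pos
  have hmax : max (wallRate (1 + Real.sqrt 2)) hexConnectiveConstant = hexConnectiveConstant := max_eq_right hβ
  rw [hmax] at h
  have hK : hexConnectiveConstant * wallRate (1 + Real.sqrt 2) ^ 2 / (1 + Real.sqrt 2) ≤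
      hexConnectiveConstant ^ 3 / (1 + Real.sqrt 2) := by
    apply div_le_div_of_nonneg_right _ yc_pos.le
    calc hexConnectiveConstant * wallRate (1 + Real.sqrt 2) ^ 2 ≤ hexConnectiveConstant * hexConnectiveConstant ^ 2 :=
          mul_le_mul_of_nonneg_left (pow_le_pow_left₀ hβ0 hβ 2) hμ.le
      _ = hexConnectiveConstant ^ 3 := by ring
  refine h.trans ?_
  have hn : (0 : ℝ) ≤ (n : ℝ) + 1 := by positivity
  exact mul_le_mul_of_nonneg_right (mul_le_mul_of_nonneg_right (mul_le_mul_of_nonneg_left hK hn)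
    (Real.exp_nonneg _)) (pow_nonneg hμ.le _)

/-! ## §3 The price of a visit: explicit exponential tails with rate `log(1 + √2)` -/

/-- ★ **Wall bridges: `#wbrVis m k ≤ (μ²/(1+√2)) · μᵐ / (1+√2)ᵏ` for all `m, k`** — at most a `(1+√2)^{-k}` fraction (against
the bulk scale `μᵐ`, constant prefactor) of `m`-step wall bridges visit the surface `k` times or more.
[cite: JansevanRensburg2000, §5.4.2, eq. (5.62); lane finite-n form] [cite: HammersleyTorrieWhittington1982, §2] [cite: BeatonBousquetMelouDeGierDuminilCopinGuttmann2014, Theorem 2 (arXiv v5 p. 3)] -/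
theorem card_wbrVis_le (m k : ℕ) :
    (#(wbrVis m k) : ℝ) ≤ hexConnectiveConstant ^ 2 / (1 + Real.sqrt 2) * hexConnectiveConstant ^ m / (1 + Real.sqrt 2) ^ k := by
  rw [le_div_iff₀ (pow_pos yc_pos k)]
  exact (card_wbrVis_mul_pow_le_WB one_le_yc m k).trans (WB_yc_le m)

/-- ★★ **Half-plane walks: `#hpwVis n k ≤ ((n+1) · (μ³/(1+√2)) · e^{12√n}) · μⁿ / (1+√2)ᵏ` for all `n, k`** — the finite-`n`,
explicit form of JvR's (5.62) `log 𝒫ᵥ⁺(ε) ≤ log μ − ε log z_c` for honeycomb half-plane self-avoiding walks, with BBdGDCG14's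
rigorous `z_c = 1 + √2`: each forced surface visit costs a factor `1 + √2`.
[cite: JansevanRensburg2000, §5.4.2, eq. (5.62); lane finite-n form] [cite: BeatonBousquetMelouDeGierDuminilCopinGuttmann2014, Theorem 2, §3.1 Proposition 5 (arXiv v5 pp. 3, 9)] [cite: HammersleyTorrieWhittington1982, §2] -/
theorem card_hpwVis_le (n k : ℕ) :
    (#(hpwVis n k) : ℝ) ≤ ((n : ℝ) + 1) * (hexConnectiveConstant ^ 3 / (1 + Real.sqrt 2)) * Real.exp (12 * Real.sqrt n) *
      hexConnectiveConstant ^ n / (1 + Real.sqrt 2) ^ k := by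
  rw [le_div_iff₀ (pow_pos yc_pos k)]
  exact (card_hpwVis_mul_pow_le_Cw one_le_yc n k).trans (Cw_yc_le n)

/-- **The general Chernoff family: `#hpwVis n k ≤ ((n+1) · (μ·μ(y)²/y) · e^{12√n}) · μ(y)ⁿ / yᵏ` for every `y ≥ 1`** (optimising
over `y` is the Legendre transform `inf_y {log μ(y) − ε log y}` of JvR's Theorem 3.19; `y = 1 + √2` is `card_hpwVis_le`).
[cite: JansevanRensburg2000, Theorem 3.19 (`log 𝒫_#(ε) = inf_{0<z<∞} {𝓕_#(z) − ε log z}`) and §5.4.2, eq. (5.62)] [cite: BeatonBousquetMelouDeGierDuminilCopinGuttmann2014, §3.1 Proposition 5 (arXiv v5 p. 9)] [cite: HammersleyTorrieWhittington1982, §2] -/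
theorem card_hpwVis_le_of_one_le (hy : 1 ≤ y) (n k : ℕ) :
    (#(hpwVis n k) : ℝ) ≤ ((n : ℝ) + 1) * (hexConnectiveConstant * surfaceMu y ^ 2 / y) * Real.exp (12 * Real.sqrt n) *
      surfaceMu y ^ n / y ^ k := by
  have hy0 : 0 < y := zero_lt_one.trans_le hy
  have hμ := hexConnectiveConstant_pos
  have hβ0 := (wallRate_pos y).le
  have hβ : wallRate y ≤ surfaceMu y := wallRate_le_surfaceMu y
  rw [le_div_iff₀ (pow_pos hy0 k)]
  refine (card_hpwVis_mul_pow_le_Cw hy n k).trans ((Cw_le hy0 n).trans ?_)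
  have hmax : max (wallRate y) hexConnectiveConstant = surfaceMu y := rfl
  rw [hmax]
  have hK : hexConnectiveConstant * wallRate y ^ 2 / y ≤ hexConnectiveConstant * surfaceMu y ^ 2 / y :=
    div_le_div_of_nonneg_right (mul_le_mul_of_nonneg_left (pow_le_pow_left₀ hβ0 hβ 2) hμ.le) hy0.le
  have hn : (0 : ℝ) ≤ (n : ℝ) + 1 := by positivity
  exact mul_le_mul_of_nonneg_right (mul_le_mul_of_nonneg_right (mul_le_mul_of_nonneg_left hK hn)
    (Real.exp_nonneg _)) (pow_nonneg (surfaceMu_pos y).le _)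

/-- The prefactor is sub-exponential: for `s > 1` and any `K`, eventually `(n+1) · K · e^{12√n} ≤ sⁿ`.
[cite: MadrasSlade1993, §3.1 (proof of Theorem 3.1.1)] [cite: HammersleyWelsh1962, Theorem] -/
theorem eventually_pricePrefactor_le_pow {s : ℝ} (hs : 1 < s) (K : ℝ) :
    ∀ᶠ n : ℕ in atTop, ((n : ℝ) + 1) * K * Real.exp (12 * Real.sqrt n) ≤ s ^ n := by
  rcases le_or_gt K 0 with hK | hK
  · exact Filter.Eventually.of_forall fun n =>
      (mul_nonpos_of_nonpos_of_nonneg (mul_nonpos_of_nonneg_of_nonpos (by positivity) hK) (Real.exp_nonneg _)).trans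
        (pow_nonneg (zero_le_one.trans hs.le) _)
  have hn1 : ∀ n : ℕ, ((n : ℝ) + 1) ≤ Real.exp (2 * Real.sqrt n) := fun n => by
    have h := Real.quadratic_le_exp_of_nonneg (show 0 ≤ 2 * Real.sqrt n by positivity)
    have hsq : Real.sqrt n ^ 2 = n := Real.sq_sqrt (Nat.cast_nonneg n)
    nlinarith [Real.sqrt_nonneg (n : ℝ), Nat.cast_nonneg (α := ℝ) n]
  filter_upwards [eventually_mul_exp_sqrt_le_pow hs K 14] with n hn
  calc ((n : ℝ) + 1) * K * Real.exp (12 * Real.sqrt n) ≤ Real.exp (2 * Real.sqrt n) * K * Real.exp (12 * Real.sqrt n) :=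
        mul_le_mul_of_nonneg_right (mul_le_mul_of_nonneg_right (hn1 n) hK.le) (Real.exp_nonneg _)
    _ = K * Real.exp (14 * Real.sqrt n) := by
        rw [show (14 : ℝ) * Real.sqrt n = 2 * Real.sqrt n + 12 * Real.sqrt n by ring, Real.exp_add]; ring
    _ ≤ s ^ n := hn

/-! ## §4 `1 + √2` is the LARGEST price: the finite form of `log z_c = −d⁺/dε log 𝒫ᵥ(ε)|_{0⁺}` -/

/-- `IsVisitPrice b`: there is a sub-exponential `C : ℕ → ℝ` (`∀ s > 1`, eventually `C n ≤ sⁿ`) with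
`#hpwVis n k ≤ C n · μⁿ / bᵏ` for ALL `n, k` — "each surface visit costs a factor `b`".
[cite: JansevanRensburg2000, §5.4.2, eqs. (5.62)–(5.63) and Lemma 3.20; lane finite-n form] -/
def IsVisitPrice (b : ℝ) : Prop :=
  ∃ C : ℕ → ℝ, (∀ s : ℝ, 1 < s → ∀ᶠ n : ℕ in atTop, C n ≤ s ^ n) ∧
    ∀ n k : ℕ, (#(hpwVis n k) : ℝ) ≤ C n * hexConnectiveConstant ^ n / b ^ k

/-- ★ **`1 + √2` is a price**, with the explicit `C(n) = (n+1) · (μ³/(1+√2)) · e^{12√n}`.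
[cite: JansevanRensburg2000, §5.4.2, eq. (5.62); lane finite-n form] [cite: BeatonBousquetMelouDeGierDuminilCopinGuttmann2014, Theorem 2 (arXiv v5 p. 3)] -/
theorem isVisitPrice_yc : IsVisitPrice (1 + Real.sqrt 2) :=
  ⟨fun n => ((n : ℝ) + 1) * (hexConnectiveConstant ^ 3 / (1 + Real.sqrt 2)) * Real.exp (12 * Real.sqrt n),
    fun _ hs => eventually_pricePrefactor_le_pow hs _, fun n k => card_hpwVis_le n k⟩

/-- The constants of a price are non-negative (take `k = 0`). [cite: JansevanRensburg2000, §5.4.2] -/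
theorem IsVisitPrice.const_nonneg {b : ℝ} {C : ℕ → ℝ}
    (h : ∀ n k : ℕ, (#(hpwVis n k) : ℝ) ≤ C n * hexConnectiveConstant ^ n / b ^ k) (n : ℕ) : 0 ≤ C n := by
  have h0 := h n 0
  rw [pow_zero, div_one] at h0
  exact nonneg_of_mul_nonneg_left ((Nat.cast_nonneg _).trans h0) (pow_pos hexConnectiveConstant_pos n)

/-- Prices are downward closed on `(0, ∞)`: a price `b` and `0 < b' ≤ b` give the price `b'`.
[cite: JansevanRensburg2000, §5.4.2] -/
theorem IsVisitPrice.mono {b b' : ℝ} (h : IsVisitPrice b) (hb' : 0 < b') (hle : b' ≤ b) : IsVisitPrice b' := by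
  obtain ⟨C, hC, hb⟩ := h
  refine ⟨C, hC, fun n k => (hb n k).trans ?_⟩
  exact div_le_div_of_nonneg_left (mul_nonneg (IsVisitPrice.const_nonneg hb n) (pow_nonneg hexConnectiveConstant_pos.le _))
    (pow_pos hb' k) (pow_le_pow_left₀ hb'.le hle k)

/-- The layer bound behind the converse: a price `b` bounds the partition function at any `1 ≤ y < b` by a geometric series,
`Cw n y ≤ C n · μⁿ · (1 − y/b)⁻¹`. [cite: JansevanRensburg2000, Lemma 3.20 and §5.4.2, eq. (5.63)] [cite: HammersleyTorrieWhittington1982, §2] -/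
theorem Cw_le_of_price {b : ℝ} {C : ℕ → ℝ}
    (h : ∀ n k : ℕ, (#(hpwVis n k) : ℝ) ≤ C n * hexConnectiveConstant ^ n / b ^ k)
    (hy : 1 ≤ y) (hyb : y < b) (n : ℕ) :
    Cw n y ≤ C n * hexConnectiveConstant ^ n * (1 - y / b)⁻¹ := by
  classical
  have hy0 : 0 ≤ y := zero_le_one.trans hy
  have hb0 : 0 < b := (zero_lt_one.trans_le hy).trans hyb
  have hq0 : 0 ≤ y / b := div_nonneg hy0 hb0.le
  have hq1 : y / b < 1 := (div_lt_one hb0).2 hyb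
  have hCn : 0 ≤ C n * hexConnectiveConstant ^ n :=
    mul_nonneg (IsVisitPrice.const_nonneg h n) (pow_nonneg hexConnectiveConstant_pos.le _)
  -- split `Cw n y` according to the number of visits `j ∈ {0, …, n}`
  have hmaps : ∀ ω ∈ hpw n, visits n ω ∈ Finset.range (n + 1) := fun ω _ =>
    Finset.mem_range.2 (Nat.lt_succ_of_le (visits_le n ω))
  have hsplit : Cw n y = ∑ j ∈ Finset.range (n + 1), ∑ ω ∈ (hpw n).filter (fun ω => visits n ω = j), y ^ visits n ω := by
    rw [Cw, ← Finset.sum_fiberwise_of_maps_to hmaps]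
  -- each fibre is bounded by `y^j · #hpwVis n j ≤ C n μⁿ (y/b)^j`
  have hfib : ∀ j ∈ Finset.range (n + 1),
      ∑ ω ∈ (hpw n).filter (fun ω => visits n ω = j), y ^ visits n ω ≤ C n * hexConnectiveConstant ^ n * (y / b) ^ j := by
    intro j _
    have hsub : (hpw n).filter (fun ω => visits n ω = j) ⊆ hpwVis n j := fun ω hω => by
      rw [Finset.mem_filter] at hω
      exact mem_hpwVis.2 ⟨hω.1, hω.2.ge⟩
    calc ∑ ω ∈ (hpw n).filter (fun ω => visits n ω = j), y ^ visits n ω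
        = ∑ ω ∈ (hpw n).filter (fun ω => visits n ω = j), y ^ j :=
          Finset.sum_congr rfl fun ω hω => by rw [(Finset.mem_filter.1 hω).2]
      _ = (#((hpw n).filter (fun ω => visits n ω = j)) : ℝ) * y ^ j := by rw [Finset.sum_const, nsmul_eq_mul]
      _ ≤ (#(hpwVis n j) : ℝ) * y ^ j :=
          mul_le_mul_of_nonneg_right (by exact_mod_cast Finset.card_le_card hsub) (pow_nonneg hy0 _)
      _ ≤ C n * hexConnectiveConstant ^ n / b ^ j * y ^ j := mul_le_mul_of_nonneg_right (h n j) (pow_nonneg hy0 _)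
      _ = C n * hexConnectiveConstant ^ n * (y / b) ^ j := by rw [div_pow]; field_simp
  have hgeom : ∑ j ∈ Finset.range (n + 1), (y / b) ^ j ≤ (1 - y / b)⁻¹ :=
    sum_le_hasSum (Finset.range (n + 1)) (fun j _ => pow_nonneg hq0 j) (hasSum_geometric_of_lt_one hq0 hq1)
  calc Cw n y = ∑ j ∈ Finset.range (n + 1), ∑ ω ∈ (hpw n).filter (fun ω => visits n ω = j), y ^ visits n ω := hsplit
    _ ≤ ∑ j ∈ Finset.range (n + 1), C n * hexConnectiveConstant ^ n * (y / b) ^ j := Finset.sum_le_sum hfib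
    _ = C n * hexConnectiveConstant ^ n * ∑ j ∈ Finset.range (n + 1), (y / b) ^ j := by rw [Finset.mul_sum]
    _ ≤ C n * hexConnectiveConstant ^ n * (1 - y / b)⁻¹ := mul_le_mul_of_nonneg_left hgeom hCn

/-- ★★ **No `b > 1 + √2` is a price** — the finite, density-function-free form of JvR's (5.63)
`log z_c = −[d⁺/dε log 𝒫ᵥ(ε)]|_{ε=0⁺}`: a price `b > y_c` would make `Cw n y` (`y_c < y < b`) grow like `μⁿ e^{o(n)}`, against
`β(y) > μ` in the adsorbed phase (BBdGDCG14 Theorem 2).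
[cite: JansevanRensburg2000, Lemma 3.20 and §5.4.2, eq. (5.63); lane finite-n form] [cite: BeatonBousquetMelouDeGierDuminilCopinGuttmann2014, Theorem 2, §3.1 Proposition 5 (arXiv v5 pp. 3, 9)] [cite: HammersleyTorrieWhittington1982, §2] -/
theorem not_isVisitPrice_of_yc_lt {b : ℝ} (hb : 1 + Real.sqrt 2 < b) : ¬ IsVisitPrice b := by
  rintro ⟨C, hC, h⟩
  -- a fugacity strictly between `y_c` and `b`
  set y : ℝ := (1 + Real.sqrt 2 + b) / 2 with hydef
  have hyc : 1 + Real.sqrt 2 < y := by rw [hydef]; linarith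
  have hyb : y < b := by rw [hydef]; linarith
  have hy1 : 1 ≤ y := one_le_yc.trans hyc.le
  have hy0 : 0 < y := zero_lt_one.trans_le hy1
  have hb0 : 0 < b := hy0.trans hyb
  have hμ := hexConnectiveConstant_pos
  -- adsorbed phase: `β(y) > μ`; pick `μ < r < β(y)` and then `1 < s < r/μ`
  have hβ : hexConnectiveConstant < wallRate y := (hexConnectiveConstant_lt_wallRate_iff hy0).2 hyc
  obtain ⟨r, hμr, hrβ⟩ := exists_between hβ
  have hr0 : 0 < r := hμ.trans hμr
  obtain ⟨s, hs1, hsr⟩ := exists_between ((one_lt_div hμ).2 hμr)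
  have hsμ0 : 0 < s * hexConnectiveConstant := mul_pos (zero_lt_one.trans hs1) hμ
  have hsμr : s * hexConnectiveConstant < r := (lt_div_iff₀ hμ).1 hsr
  -- the three eventualities
  set c : ℝ := r ^ 2 / y * min 1 r⁻¹ with hcdef
  have hc0 : 0 < c := mul_pos (div_pos (pow_pos hr0 2) hy0) (lt_min one_pos (inv_pos.2 hr0))
  set K : ℝ := (1 - y / b)⁻¹ with hKdef
  have hK0 : 0 < K := inv_pos.2 (sub_pos.2 ((div_lt_one hb0).2 hyb))
  have hev1 := eventually_mul_pow_le_Cw hy0 hr0 hrβ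
  have hev2 := hC s hs1
  have hq : 1 < r / (s * hexConnectiveConstant) := (one_lt_div hsμ0).2 hsμr
  have hev3 := (tendsto_pow_atTop_atTop_of_one_lt hq).eventually_ge_atTop (K / c + 1)
  obtain ⟨m, h1, h2, h3⟩ := (hev1.and (hev2.and hev3)).exists
  -- `c r^m ≤ Cw m y ≤ C m μ^m K ≤ (sμ)^m K` but `(r/(sμ))^m ≥ K/c + 1`
  have hA : c * r ^ m ≤ K * (s * hexConnectiveConstant) ^ m :=
    calc c * r ^ m ≤ Cw m y := h1
      _ ≤ C m * hexConnectiveConstant ^ m * K := Cw_le_of_price h hy1 hyb m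
      _ ≤ s ^ m * hexConnectiveConstant ^ m * K :=
          mul_le_mul_of_nonneg_right (mul_le_mul_of_nonneg_right h2 (pow_nonneg hμ.le _)) hK0.le
      _ = K * (s * hexConnectiveConstant) ^ m := by rw [mul_pow]; ring
  have hpow : 0 < (s * hexConnectiveConstant) ^ m := pow_pos hsμ0 m
  have hB : (K / c + 1) * (s * hexConnectiveConstant) ^ m ≤ r ^ m := by
    have := h3
    rw [div_pow, le_div_iff₀ hpow] at this
    exact this
  have hB' : (K + c) * (s * hexConnectiveConstant) ^ m ≤ c * r ^ m := by
    have := mul_le_mul_of_nonneg_left hB hc0.le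
    calc (K + c) * (s * hexConnectiveConstant) ^ m = c * ((K / c + 1) * (s * hexConnectiveConstant) ^ m) := by
          field_simp
      _ ≤ c * r ^ m := this
  nlinarith [mul_pos hc0 hpow]

/-- ★★ **The critical surface fugacity is the price of a surface visit: for `b > 0`, `IsVisitPrice b ↔ b ≤ 1 + √2`.**
[cite: JansevanRensburg2000, §5.4.2, eqs. (5.62)–(5.63), Lemma 3.20; lane finite-n form] [cite: BeatonBousquetMelouDeGierDuminilCopinGuttmann2014, Theorem 2 (arXiv v5 p. 3)] [cite: HammersleyTorrieWhittington1982, §2] -/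
theorem isVisitPrice_iff {b : ℝ} (hb : 0 < b) : IsVisitPrice b ↔ b ≤ 1 + Real.sqrt 2 :=
  ⟨fun h => not_lt.1 fun hlt => not_isVisitPrice_of_yc_lt hlt h, fun h => isVisitPrice_yc.mono hb h⟩

/-- `1 + √2` is the greatest price. [cite: JansevanRensburg2000, §5.4.2, eq. (5.63); lane finite-n form] [cite: BeatonBousquetMelouDeGierDuminilCopinGuttmann2014, Theorem 2 (arXiv v5 p. 3)] -/
theorem isGreatest_isVisitPrice : IsGreatest {b : ℝ | IsVisitPrice b} (1 + Real.sqrt 2) :=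
  ⟨isVisitPrice_yc, fun _ hb => not_lt.1 fun hlt => not_isVisitPrice_of_yc_lt hlt hb⟩

end Literature.Probability.RandomPlanarGeometry.SAW.HexBW.Wall

end
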